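import Summits.BirchSwinnertonDyer.Rank1Residual.WAll.TargetAdditiveAtThreeWildTwinSlices
import Literature.NumberTheory.EllipticCurves.GreenbergSelmer
import HarnessLib
import HarnessLib.Audit.Tags

/-!
# Rung W-ALL of ladder BSD (D-0120) — row 2 at `p = 3`, WILD rank one, onto image: the twin cell
# RE-SLICED along the LOCAL «semistable mod-3 type» predicate (cell `bsd-wall`, lane (2), seat
# `bsd-wall-ty-1`; new small file importing `WAll.TargetAdditiveAtThreeWildTwinSlices`)

HONEST FRAMING (cell `bsd-wall`, run/shared/lean/pub/bsd-wall/; brief `WALL-BRIEF-v1.md` sha16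
b966bf16da27706e §2): STATEMENTS, VOCABULARY AND BOOKKEEPING ONLY — nothing asserted, nothing booked,
no named fact, no published theorem restated. §0 adds two plain predicates (local vocabulary, bodies
given); every `@[conjecture] def` of §§1–2 is an OPEN obligation; §3 is glue PROVED from excluded
middle and from the unconditional direction «a global twin witnesses the local type».

WHY (planner seat `bsd-wall-pss3` g2, memo `HOME/bsd-wall-pss3/rev2/TWIN-CRITERION-v1.md` sha16
be257d6bc26b8781, §«Typed predicate for ty-1»; census spec TWIN-CENSUS-SPEC-v1.md b715004e30f63613):
the attacked cell of route `UniversalToricDescent` is the landed leaf `WAllExclAddWildRankOneSurjTwin`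
(«`ρ̄_{E,3}` onto ∧ ∃ a semistable-at-`3` mod-`3` twin `E′/ℚ`» ⇒ `BSD(E,3)`), whose mass is not
decidable per curve as stated (a GLOBAL existential). The planner's TWIN CRITERION (claimed, proof
sketch in the memo; inputs Fisher 2012 Thm. 13.2 — `X_E(3) ≅ ℙ¹` and `X_E^-(3) ≅ ℙ¹` with the
Hesse / dual-Hesse families —, Rubin–Silverberg 1995, `3`-adic openness of the semistable locus,
weak approximation on `ℙ¹`, local realisability by Tate curves / `y² = x³ − x`): a twin exists iff
`σ := ρ̄_{E,3}|_{G_{ℚ₃}}` is of SEMISTABLE TYPE (reducible with a stable line on which inertia acts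
non-trivially, or split, or irreducible of the good-supersingular type `ω₂ ⊕ ω₂³`), a LOCAL condition
the census decides from `ψ₃` over `ℚ₃`. This file types that condition in tree vocabulary —
`O6.HasSemistableModPTypeAt W 3`: «at the place above `3`, the `D₃`-module `W[3]` is isomorphic to
`W″[3]` for SOME elliptic curve `W″/ℚ` semistable at `3`» (GLOBAL witnesses, LOCAL equivariance:
between «∃ global twin» and the memo's «∃ semistable `W″/ℚ₃`», all three equivalent under the
criterion) —, re-slices the onto atom along it, states the criterion's hard direction as ONE named
open obligation `TwinOfSemistableTypeAtThree` (the easy direction «twin ⇒ type» is PROVED,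
`O6.hasSemistableModPTypeAt_of_twin`), and proves the glue both ways (unconditional where it is,
displayed `hcrit` where it is not).

CONTENTS: §0 `O6.ModPCongruentAt W W' p v` (the LOCAL form of `O6.ModPCongruent`: a `D_v`-equivariant
additive iso `W[p] ≃ W'[p]`; refl/symm/trans; global ⇒ local) and `O6.HasSemistableModPTypeAt W p`
(+ `…_of_twin`, `…_of_not_addv`, invariance under congruence). §1 leaves
`WAllExclAddWildRankOneSurjSemistableType` (onto ∧ semistable local type ⇒ `BSD(E,3)`; = the
census's #twin column under the criterion) / `WAllExclAddWildRankOneSurjNonSemistableType` (onto ∧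
NOT of semistable type; = #no-twin). §2 `TwinOfSemistableTypeAtThree` (the criterion, hard direction,
OPEN). §3 glue: `wAllExclAddWildRankOneSurj_iff_semistableType_nonSemistableType` (EXACT);
UNCONDITIONAL `…SurjTwin_of_surjSemistableType` (type-cell leaf ⇒ twin-cell leaf) and
`…SurjNonSemistableType_of_surjTwinless` (twinless ⇒ non-type leaf); modulo `hcrit :
TwinOfSemistableTypeAtThree` the converses and the two `_iff_`; both new leaves ⇐ `WAll`; registry
key `wAllExclAddWildRankOne_of_localTypeAtoms` (wild r1 leaf ⇐ type cell, non-type, normaliser,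
reducible — unconditional).

References: `WAll/TargetAdditiveAtThreeWildTwinSlices.lean` (p514681; the twin slices and
`wAllExclAddWildRankOneSurj_iff_surjTwin_surjTwinless`, `wAllExclAddWildRankOne_iff_twinAtoms`),
`Rank1Residual/O6/X4CongruenceAnchor.lean` (`O6.ModPCongruent`),
`Literature/NumberTheory/EllipticCurves/GreenbergSelmer.lean` (`decomp v`),
`Literature/NumberTheory/EllipticCurves/GaloisAction.lean` (`geomTorsion`, the `Γ_ℚ`-action); route
file `Summits/BirchSwinnertonDyer/BirchSwinnertonDyer/Theses/UniversalToricDescent.lean` (rev 3);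
[cite: Fisher2012Hessian, Thm. 13.2 and §13] [cite: RubinSilverberg1995, Thm. 4.1]
[cite: SerreInventiones1972, §1.11 Prop. 11–12 and §1.12] (the semistable local types);
[cite: Miller2011LMS, §1 and Def. 1.1] (the currency `BSD(E,p)`).
-/

noncomputable section

open scoped Classical

open NumberField IsDedekindDomain
open WeierstrassCurve Literature.NumberTheory.EllipticCurves
  Literature.NumberTheory.EllipticCurves.Rank1Residual Literature.NumberTheory.EllipticCurves.ModularForms
  Literature.NumberTheory.EllipticCurves.GreenbergSelmer
open Summit.BirchSwinnertonDyer.Rank1Residual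

set_option autoImplicit false

/-! ### §0. Local vocabulary: congruence at a place, semistable mod-`p` type at `p` -/

namespace Summit.BirchSwinnertonDyer.Rank1Residual.O6

/-- **Mod-`p` congruence AT THE PLACE `v`** of two curves over `ℚ`: an additive isomorphism
`W[p] ≃ W'[p]` of the geometric `p`-torsion, equivariant for the decomposition group `D_v ≤ Γ_ℚ`
(`GreenbergSelmer.decomp v`, the image of `Γ_{ℚ_v}` for the tree's chosen embedding) — the LOCAL form
of `O6.ModPCongruent` (which asks `Γ_ℚ`-equivariance): `W[p]|_{G_{ℚ_v}} ≅ W'[p]|_{G_{ℚ_v}}`.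
Serre (1972) §1; Silverman, *AEC*, III.§7. [folklore] -/
def ModPCongruentAt (W W' : WeierstrassCurve ℚ) (p : ℕ) (v : HeightOneSpectrum (𝓞 ℚ)) : Prop :=
  ∃ e : W.geomTorsion (p : ℤ) ≃+ W'.geomTorsion (p : ℤ),
    ∀ σ ∈ decomp (K := ℚ) v, ∀ P : W.geomTorsion (p : ℤ), e (σ • P) = σ • e P

variable {W W' W'' : WeierstrassCurve ℚ} {p : ℕ} {v : HeightOneSpectrum (𝓞 ℚ)}

/-- Global ⇒ local: a mod-`p` congruence (`Γ_ℚ`-equivariant) is a congruence at every place.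
[folklore] -/
theorem ModPCongruent.modPCongruentAt (h : ModPCongruent W W' p) (v : HeightOneSpectrum (𝓞 ℚ)) :
    ModPCongruentAt W W' p v := by
  obtain ⟨e, he⟩ := h
  exact ⟨e, fun σ _ P ↦ he σ P⟩

/-- Local congruence is reflexive. [folklore] -/
theorem ModPCongruentAt.refl (W : WeierstrassCurve ℚ) (p : ℕ) (v : HeightOneSpectrum (𝓞 ℚ)) :
    ModPCongruentAt W W p v :=
  ⟨AddEquiv.refl _, fun _ _ _ ↦ rfl⟩

/-- Local congruence is symmetric. [folklore] -/
theorem ModPCongruentAt.symm (h : ModPCongruentAt W W' p v) : ModPCongruentAt W' W p v := by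
  obtain ⟨e, he⟩ := h
  refine ⟨e.symm, fun σ hσ Q ↦ ?_⟩
  apply e.injective
  rw [AddEquiv.apply_symm_apply, he σ hσ, AddEquiv.apply_symm_apply]

/-- Local congruence is transitive. [folklore] -/
theorem ModPCongruentAt.trans (h₁ : ModPCongruentAt W W' p v) (h₂ : ModPCongruentAt W' W'' p v) :
    ModPCongruentAt W W'' p v := by
  obtain ⟨e₁, he₁⟩ := h₁
  obtain ⟨e₂, he₂⟩ := h₂
  refine ⟨e₁.trans e₂, fun σ hσ P ↦ ?_⟩
  rw [AddEquiv.trans_apply, AddEquiv.trans_apply, he₁ σ hσ, he₂ σ hσ]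

/-- **`W/ℚ` has SEMISTABLE mod-`p` TYPE at `p`**: at the place `v` of `ℚ` above `p`, the
`D_v`-module `W[p]` is isomorphic to `W″[p]` for some elliptic curve over `ℚ` (globally minimal model
`W″`) with good or multiplicative reduction at `p` (`¬ Addv W″ p`). GLOBAL witnesses, LOCAL
equivariance. For `p = 3`, onto image, this types the planner's «`σ = ρ̄|_{G_{ℚ₃}}` of semistable
type» (memo TWIN-CRITERION-v1: reducible with a stable line on which inertia acts non-trivially, or
split, or irreducible with `σ|_{I₃} ≅ ω₂ ⊕ ω₂³`) — the semistable local structures of Serre 1972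
§1.11 (good ordinary Prop. 11, supersingular Prop. 12) and §1.12 (Tate curve). Twin ⇒ type is
`hasSemistableModPTypeAt_of_twin`; type ⇒ twin is the open criterion `TwinOfSemistableTypeAtThree`.
[folklore] -/
def HasSemistableModPTypeAt (W : WeierstrassCurve ℚ) (p : ℕ) [Fact p.Prime] : Prop :=
  ∀ (v : HeightOneSpectrum (𝓞 ℚ)), ((p : ℕ) : 𝓞 ℚ) ∈ v.asIdeal →
    ∃ (W'' : WeierstrassCurve ℚ) (_ : W''.IsElliptic) (_ : W''.IsGloballyMinimal),
      ¬ Addv W'' p ∧ ModPCongruentAt W'' W p v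

variable [Fact p.Prime]

/-- A semistable-at-`p` curve congruent to `W` AT the place above `p` witnesses the type. [folklore] -/
theorem hasSemistableModPTypeAt_of_modPCongruentAt (W'' : WeierstrassCurve ℚ) [W''.IsElliptic]
    [W''.IsGloballyMinimal] (hss : ¬ Addv W'' p)
    (hc : ∀ (v : HeightOneSpectrum (𝓞 ℚ)), ((p : ℕ) : 𝓞 ℚ) ∈ v.asIdeal → ModPCongruentAt W'' W p v) :
    HasSemistableModPTypeAt W p :=
  fun v hv ↦ ⟨W'', ‹_›, ‹_›, hss, hc v hv⟩

/-- **Twin ⇒ type (unconditional)**: a GLOBAL mod-`p` twin semistable at `p` (`O6.ModPCongruent W″ W p`,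
`¬ Addv W″ p`) witnesses the semistable mod-`p` type. [folklore] -/
theorem hasSemistableModPTypeAt_of_twin (W'' : WeierstrassCurve ℚ) [W''.IsElliptic]
    [W''.IsGloballyMinimal] (hc : ModPCongruent W'' W p) (hss : ¬ Addv W'' p) :
    HasSemistableModPTypeAt W p :=
  hasSemistableModPTypeAt_of_modPCongruentAt W'' hss fun v _ ↦ hc.modPCongruentAt v

/-- A curve semistable at `p` (on a globally minimal model) has semistable type (witness: itself).
[folklore] -/
theorem hasSemistableModPTypeAt_of_not_addv [W.IsElliptic] [W.IsGloballyMinimal] (h : ¬ Addv W p) :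
    HasSemistableModPTypeAt W p :=
  hasSemistableModPTypeAt_of_modPCongruentAt W h fun v _ ↦ ModPCongruentAt.refl W p v

/-- The type is invariant under congruence at the place above `p`. [folklore] -/
theorem HasSemistableModPTypeAt.of_modPCongruentAt (h : HasSemistableModPTypeAt W p)
    (hc : ∀ (v : HeightOneSpectrum (𝓞 ℚ)), ((p : ℕ) : 𝓞 ℚ) ∈ v.asIdeal → ModPCongruentAt W W' p v) :
    HasSemistableModPTypeAt W' p := by
  intro v hv
  obtain ⟨W'', h1, h2, hss, hW⟩ := h v hv
  exact ⟨W'', h1, h2, hss, hW.trans (hc v hv)⟩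

/-- The type is invariant under (global) mod-`p` congruence. [folklore] -/
theorem HasSemistableModPTypeAt.of_modPCongruent (h : HasSemistableModPTypeAt W p)
    (hc : ModPCongruent W W' p) : HasSemistableModPTypeAt W' p :=
  h.of_modPCongruentAt fun v _ ↦ hc.modPCongruentAt v

end Summit.BirchSwinnertonDyer.Rank1Residual.O6

namespace Summit.BirchSwinnertonDyer

/-! ### §1. The onto atom of the wild rank-one leaf, cut along the semistable local type -/

/-- **Wild additive `3`, rank one, onto image, SEMISTABLE mod-`3` TYPE (OPEN)**: non-CM,
`Additive.ClassO6 W 3`, `r = 1`, `ρ̄_{E,3}` onto, `O6.HasSemistableModPTypeAt W 3` ⇒ `BSD(E,3)` — the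
attacked cell of route `UniversalToricDescent` read through the planner's twin criterion (its
census column #twin: classes whose `ρ̄|_{G_{ℚ₃}}` is of semistable type; of the `3 894` onto classes
of record, count owed by the kit seat per TWIN-CENSUS-SPEC-v1). Implies the twin-cell leaf
unconditionally (`wAllExclAddWildRankOneSurjTwin_of_surjSemistableType`); equivalent to it modulo
`TwinOfSemistableTypeAtThree`. [folklore] -/
@[conjecture] def WAllExclAddWildRankOneSurjSemistableType : Prop :=
  ∀ (W : WeierstrassCurve ℚ) [W.IsElliptic] [W.IsGloballyMinimal],
    ¬ W.HasCM → Additive.ClassO6 W 3 → W.analyticRank = 1 → W.HasSurjectiveModNGaloisRep 3 →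
      O6.HasSemistableModPTypeAt W 3 → BSDp W 3

/-- **Wild additive `3`, rank one, onto image, NOT of semistable mod-`3` type (OPEN)**: non-CM,
`Additive.ClassO6 W 3`, `r = 1`, `ρ̄_{E,3}` onto, `¬ O6.HasSemistableModPTypeAt W 3` (memo: the
reducible non-split type with UNRAMIFIED stable line, or the irreducible type `ω₂⁵ ⊕ ω₂⁷`; by twist
duality exactly one of `E`, `E^{(−3)}` is of semistable type when `σ` is non-split) ⇒ `BSD(E,3)` — the
census column #no-twin; implied by the twinless atom unconditionally
(`wAllExclAddWildRankOneSurjNonSemistableType_of_surjTwinless`). [folklore] -/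
@[conjecture] def WAllExclAddWildRankOneSurjNonSemistableType : Prop :=
  ∀ (W : WeierstrassCurve ℚ) [W.IsElliptic] [W.IsGloballyMinimal],
    ¬ W.HasCM → Additive.ClassO6 W 3 → W.analyticRank = 1 → W.HasSurjectiveModNGaloisRep 3 →
      ¬ O6.HasSemistableModPTypeAt W 3 → BSDp W 3

/-! ### §2. The twin criterion (hard direction) as ONE named open obligation -/

/-- **TWIN CRITERION at `3`, hard direction (OPEN obligation; the planner's claimed theorem, NOT a
published statement and NOT asserted)**: a globally minimal `W/ℚ`, wild additive at `3`
(`Additive.ClassO6 W 3`) with `ρ̄_{E,3}` onto and of semistable mod-`3` type admits a GLOBAL mod-`3`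
twin `W′/ℚ` (globally minimal, `O6.ModPCongruent W′ W 3`) that is semistable at `3` with onto image
— memo TWIN-CRITERION-v1 §Criterion/§Proof sketch: the families of curves directly / reversely
`3`-congruent to `E` are `X_E(3) ≅ ℙ¹`, `X_E^-(3) ≅ ℙ¹` over `ℚ` (Fisher 2012 Thm. 13.2, Hesse and dual
Hesse polynomials; Rubin–Silverberg 1995 Thm. 4.1), the semistable locus in `X_E(3)(ℚ₃)` is
`3`-adically open and non-empty iff the local type is semistable (realised symplectically or, via
`X_E^-`, anti-symplectically), and weak approximation on `ℙ¹` gives the rational twin. The easy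
direction is the theorem `O6.hasSemistableModPTypeAt_of_twin`. Routes that use this take it as a
support item (shape verbatim) or prove it. [cite: Fisher2012Hessian, Thm. 13.2 and §13]
[cite: RubinSilverberg1995, Thm. 4.1] -/
@[conjecture] def TwinOfSemistableTypeAtThree : Prop :=
  ∀ (W : WeierstrassCurve ℚ) [W.IsElliptic] [W.IsGloballyMinimal],
    Additive.ClassO6 W 3 → W.HasSurjectiveModNGaloisRep 3 → O6.HasSemistableModPTypeAt W 3 →
      ∃ (W' : WeierstrassCurve ℚ) (_ : W'.IsElliptic) (_ : W'.IsGloballyMinimal),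
        O6.ModPCongruent W' W 3 ∧ ¬ Addv W' 3 ∧ W'.HasSurjectiveModNGaloisRep 3

/-! ### §3. Glue -/

/-- **The landed onto atom ⟺ semistable-type cell ∧ non-semistable-type cell** (excluded middle on
the local type; EXACT). [folklore] -/
theorem wAllExclAddWildRankOneSurj_iff_semistableType_nonSemistableType :
    WAllExclAddWildRankOneSurj ↔
      WAllExclAddWildRankOneSurjSemistableType ∧ WAllExclAddWildRankOneSurjNonSemistableType :=
  ⟨fun h ↦ ⟨fun W _ _ hcm hO hr hs _ ↦ h W hcm hO hs hr, fun W _ _ hcm hO hr hs _ ↦ h W hcm hO hs hr⟩,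
    fun ⟨hT, hN⟩ W _ _ hcm hO hs hr ↦ by
      by_cases htype : O6.HasSemistableModPTypeAt W 3
      · exact hT W hcm hO hr hs htype
      · exact hN W hcm hO hr hs htype⟩

/-- A global twin as in the twin-cell leaf witnesses the semistable type (unconditional direction of
the criterion, packaged on the leaf's existential). [folklore] -/
theorem hasSemistableModPTypeAt_three_of_twin {W : WeierstrassCurve ℚ}
    (htwin : ∃ (W' : WeierstrassCurve ℚ) (_ : W'.IsElliptic) (_ : W'.IsGloballyMinimal),
      O6.ModPCongruent W' W 3 ∧ ¬ Addv W' 3 ∧ W'.HasSurjectiveModNGaloisRep 3) :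
    O6.HasSemistableModPTypeAt W 3 := by
  obtain ⟨W', h1, h2, hc, hss, -⟩ := htwin
  exact O6.hasSemistableModPTypeAt_of_twin W' hc hss

/-- **Type cell ⇒ twin cell (UNCONDITIONAL)**: the semistable-type leaf implies the landed twin-cell
leaf `WAllExclAddWildRankOneSurjTwin`, since a twin witnesses the type. [folklore] -/
theorem wAllExclAddWildRankOneSurjTwin_of_surjSemistableType
    (h : WAllExclAddWildRankOneSurjSemistableType) : WAllExclAddWildRankOneSurjTwin :=
  fun W _ _ hcm hO hr hs htwin ↦ h W hcm hO hr hs (hasSemistableModPTypeAt_three_of_twin htwin)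

/-- **Twinless ⇒ non-type cell (UNCONDITIONAL)**: a curve NOT of semistable type has no twin, so the
landed twinless atom closes the non-semistable-type leaf. [folklore] -/
theorem wAllExclAddWildRankOneSurjNonSemistableType_of_surjTwinless
    (h : WAllExclAddWildRankOneSurjTwinless) : WAllExclAddWildRankOneSurjNonSemistableType :=
  fun W _ _ hcm hO hr hs hnt ↦
    h W hcm hO hr hs fun htwin ↦ hnt (hasSemistableModPTypeAt_three_of_twin htwin)

/-- **Twin cell ⇒ type cell, modulo the criterion** (`hcrit : TwinOfSemistableTypeAtThree`).
[folklore] -/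
theorem wAllExclAddWildRankOneSurjSemistableType_of_surjTwin (hcrit : TwinOfSemistableTypeAtThree)
    (h : WAllExclAddWildRankOneSurjTwin) : WAllExclAddWildRankOneSurjSemistableType :=
  fun W _ _ hcm hO hr hs htype ↦ h W hcm hO hr hs (hcrit W hO hs htype)

/-- **Non-type cell ⇒ twinless, modulo the criterion.** [folklore] -/
theorem wAllExclAddWildRankOneSurjTwinless_of_surjNonSemistableType
    (hcrit : TwinOfSemistableTypeAtThree) (h : WAllExclAddWildRankOneSurjNonSemistableType) :
    WAllExclAddWildRankOneSurjTwinless :=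
  fun W _ _ hcm hO hr hs hnt ↦ h W hcm hO hr hs fun htype ↦ hnt (hcrit W hO hs htype)

/-- **Twin cell ⟺ type cell, modulo the criterion.** [folklore] -/
theorem wAllExclAddWildRankOneSurjTwin_iff_surjSemistableType (hcrit : TwinOfSemistableTypeAtThree) :
    WAllExclAddWildRankOneSurjTwin ↔ WAllExclAddWildRankOneSurjSemistableType :=
  ⟨wAllExclAddWildRankOneSurjSemistableType_of_surjTwin hcrit,
    wAllExclAddWildRankOneSurjTwin_of_surjSemistableType⟩

/-- **Twinless ⟺ non-type cell, modulo the criterion.** [folklore] -/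
theorem wAllExclAddWildRankOneSurjTwinless_iff_surjNonSemistableType
    (hcrit : TwinOfSemistableTypeAtThree) :
    WAllExclAddWildRankOneSurjTwinless ↔ WAllExclAddWildRankOneSurjNonSemistableType :=
  ⟨wAllExclAddWildRankOneSurjNonSemistableType_of_surjTwinless,
    wAllExclAddWildRankOneSurjTwinless_of_surjNonSemistableType hcrit⟩

/-- **The route's kernel shape ⇒ the type cell, modulo the criterion** — the one-liner by which a
deciding theorem concluding `BSD(E,3)` from an actual twin (route item `ToricKernelAtThree`'s shape,
no `¬CM` binder) closes `WAllExclAddWildRankOneSurjSemistableType` if the route takes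
`TwinOfSemistableTypeAtThree` as a support item. [folklore] -/
theorem wAllExclAddWildRankOneSurjSemistableType_of_forall (hcrit : TwinOfSemistableTypeAtThree)
    (h : ∀ (W : WeierstrassCurve ℚ) [W.IsElliptic] [W.IsGloballyMinimal],
      Additive.ClassO6 W 3 → W.analyticRank = 1 → W.HasSurjectiveModNGaloisRep 3 →
        (∃ (W' : WeierstrassCurve ℚ) (_ : W'.IsElliptic) (_ : W'.IsGloballyMinimal),
          O6.ModPCongruent W' W 3 ∧ ¬ Addv W' 3 ∧ W'.HasSurjectiveModNGaloisRep 3) → BSDp W 3) :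
    WAllExclAddWildRankOneSurjSemistableType :=
  wAllExclAddWildRankOneSurjSemistableType_of_surjTwin hcrit (wAllExclAddWildRankOneSurjTwin_of_forall h)

/-- The two local-type slices follow from `WAll` (each is an instance of it). [folklore] -/
theorem localTypeSlices_of_wAll (h : WAll) :
    WAllExclAddWildRankOneSurjSemistableType ∧ WAllExclAddWildRankOneSurjNonSemistableType :=
  wAllExclAddWildRankOneSurj_iff_semistableType_nonSemistableType.1
    (wAllExclAddWildRankOneSurj_iff_surjTwin_surjTwinless.2
      ⟨(twinSlices_of_wAll h).1, (twinSlices_of_wAll h).2.2⟩)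

/-- **Wild rank one ⇐ type cell ∧ non-type cell ∧ normaliser ∧ reducible** (registry key,
UNCONDITIONAL: the two local-type slices give back the onto atom exactly). [folklore] -/
theorem wAllExclAddWildRankOne_of_localTypeAtoms (hT : WAllExclAddWildRankOneSurjSemistableType)
    (hN : WAllExclAddWildRankOneSurjNonSemistableType) (hI : WAllExclAddWildRankOneIrrNotSurj)
    (hR : WAllExclAddWildRankOneRed) : WAllExclAddWildRankOne :=
  have hs : WAllExclAddWildRankOneSurj :=
    wAllExclAddWildRankOneSurj_iff_semistableType_nonSemistableType.2 ⟨hT, hN⟩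
  wAllExclAddWildRankOne_of_twinAtoms (wAllExclAddWildRankOneSurjTwin_of_surj hs)
    (wAllExclAddWildRankOneSurjTwinless_of_surj hs) hI hR

/-- Conversely the wild rank-one leaf restricts to the two local-type slices. [folklore] -/
theorem localTypeSlices_of_wAllExclAddWildRankOne (h : WAllExclAddWildRankOne) :
    WAllExclAddWildRankOneSurjSemistableType ∧ WAllExclAddWildRankOneSurjNonSemistableType :=
  ⟨fun W _ _ hcm hO hr _ _ ↦ h W hcm hO hr, fun W _ _ hcm hO hr _ _ ↦ h W hcm hO hr⟩

end Summit.BirchSwinnertonDyer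

end
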